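import Summits.Ventures.LatticeQCDFlow.Scoring.WilsonFlowRK3Consistency
import Summits.Ventures.LatticeQCDFlow.Scoring.SU2CoolingFixedPoints
import HarnessLib

/-!
# Fixed points of the RK3 integrator are EXACTLY the stationary points of the Wilson flow; cooling-stable `SU(2)` configurations are fixed by the engine's flow step

HONEST FRAMING: exact (Metropolis-corrected) sampling algorithms for lattice gauge theory;
figures of merit are autocorrelation/cost numbers at stated couplings and volumes; no
continuum-physics claim.

Venture `LatticeQCDFlow` (cell pub-lqcd), sub-topic `Scoring`; FANOUT row 16 (`su2-base`, whose two charge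
definitions smooth the field by the engine's RK3 Wilson-flow step — `Scoring/WilsonFlowRK3*` — and by cooling —
`Scoring/SU2Cooling*`).  NEW WORK of the cell; nothing cited as a fact; no number.  It closes the circle
opened by `SU2CoolingFixedPoints` ("the two smoothings share their fixed points", proved there for the EXACT
flow `wilsonFlow t`) at the level of what the engine computes.

## What is here

* **`wilsonFlowRK3_eq_self_iff`** (every `d`, `n`, `L ≥ 1`): `RK3_ε V = V` for EVERY step size `ε` **iff**
  the flow vector field vanishes at `V` (`−P(Ω_e(V)) V_e = 0` on every link) — the "if" is
  `wilsonFlowRK3_eq_self_of_wilsonFlowVF_eq_zero`; the "only if" differentiates the constant curve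
  `ε ↦ RK3_ε(V)(e)` at `0` (`hasDerivAt_wilsonFlowRK3_zero`, uniqueness of derivatives).  It suffices that
  `RK3_ε V = V` for all `ε` near `0` (`wilsonFlowVF_eq_zero_of_eventually_eq_self`).  Hence
  **`wilsonFlowRK3_eq_self_iff_wilsonFlow_eq_self`**: the universal fixed points of the integrator are exactly
  the fixed points of the exact flow (`wilsonFlow t V = V` for all `t`).
* (`n = 2`) **`wilsonFlowRK3_eq_self_of_su2Cool_eq_self`**: a configuration that no `SU(2)` cooling update
  moves (the engine's `update_link` mode 2 = `su2Cool`, gen-3's `SU2CoolingMap`) is fixed by the engine's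
  flow step for every `ε`, hence by every number of steps (`iterate_wilsonFlowRK3_eq_self_of_su2Cool_eq_self`);
  relational form for every exact cooling implementation, `L ≥ 2`
  (`wilsonFlowRK3_eq_self_of_isCoolingStep_self`).  The converse fails exactly at configurations with an
  anti-aligned link (`SU2CoolingFixedPoints.wilsonFlowVF_eq_zero_iff_aligned`), as for the exact flow.

NOT here: attraction / stability of these fixed points under either smoothing; any number.
-/

noncomputable section

open Matrix Filter Topology Literature.MathematicalPhysics.QuantumFieldTheory
open Literature.MathematicalPhysics.QuantumLattice (fundamentalRep)

namespace Summit.Ventures.LatticeQCDFlow.Scoring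

variable {d L n : ℕ}

/-! ## §1 Universal fixed points of the integrator = stationary points of the flow -/

section FixedPoints

open scoped Matrix.Norms.Frobenius

variable [NeZero L]

/-- If `RK3_ε V` agrees with `V` on the link `e` for all `ε` near `0`, the flow vector field vanishes at `e`
(the constant curve has derivative `0`; by `hasDerivAt_wilsonFlowRK3_zero` its derivative is
`wilsonFlowVF V e`). -/
theorem wilsonFlowVF_eq_zero_of_eventually_eq_self {V : GaugeConfig d L (Matrix.specialUnitaryGroup (Fin n) ℂ)}
    {e : Edge d L} (h : ∀ᶠ ε in 𝓝 (0 : ℝ), wilsonFlowRK3 ε V e = V e) : wilsonFlowVF V e = 0 := by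
  have h1 := hasDerivAt_wilsonFlowRK3_zero V e
  have h2 : HasDerivAt (fun ε : ℝ =>
      ((wilsonFlowRK3 ε V e : Matrix.specialUnitaryGroup (Fin n) ℂ) : Matrix (Fin n) (Fin n) ℂ)) 0 0 := by
    refine (hasDerivAt_const (0 : ℝ)
      (((V e : Matrix.specialUnitaryGroup (Fin n) ℂ) : Matrix (Fin n) (Fin n) ℂ))).congr_of_eventuallyEq ?_
    filter_upwards [h] with ε hε
    rw [hε]
  exact h1.unique h2

/-- **`RK3_ε V = V` for every `ε` iff the Wilson-flow vector field vanishes at `V`.** -/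
theorem wilsonFlowRK3_eq_self_iff (V : GaugeConfig d L (Matrix.specialUnitaryGroup (Fin n) ℂ)) :
    (∀ ε : ℝ, wilsonFlowRK3 ε V = V) ↔ ∀ e, wilsonFlowVF V e = 0 := by
  constructor
  · intro h e
    exact wilsonFlowVF_eq_zero_of_eventually_eq_self (Eventually.of_forall fun ε => by rw [h ε])
  · intro h ε
    exact wilsonFlowRK3_eq_self_of_wilsonFlowVF_eq_zero h ε

/-- It suffices to be fixed for all SMALL step sizes. -/
theorem wilsonFlowRK3_eq_self_of_eventually {V : GaugeConfig d L (Matrix.specialUnitaryGroup (Fin n) ℂ)}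
    (h : ∀ᶠ ε in 𝓝 (0 : ℝ), wilsonFlowRK3 ε V = V) (ε : ℝ) : wilsonFlowRK3 ε V = V :=
  wilsonFlowRK3_eq_self_of_wilsonFlowVF_eq_zero
    (fun e => wilsonFlowVF_eq_zero_of_eventually_eq_self (h.mono fun ε' hε' => by rw [hε'])) ε

/-- **The universal fixed points of the integrator are exactly the fixed points of the exact flow.** -/
theorem wilsonFlowRK3_eq_self_iff_wilsonFlow_eq_self (V : GaugeConfig d L (Matrix.specialUnitaryGroup (Fin n) ℂ)) :
    (∀ ε : ℝ, wilsonFlowRK3 ε V = V) ↔ ∀ t : ℝ, wilsonFlow t V = V := by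
  rw [wilsonFlowRK3_eq_self_iff]
  constructor
  · intro h t
    exact wilsonFlow_eq_self_of_wilsonFlowVF_eq_zero h t
  · intro h e
    have hd := hasDerivAt_wilsonFlow V 0 e
    have key : ∀ i j : Fin n, wilsonFlowVF V e i j = 0 := by
      intro i j
      have h1 := hd i j
      rw [wilsonFlow_zero] at h1
      have h2 : HasDerivAt (fun s : ℝ =>
          ((wilsonFlow s V e : Matrix.specialUnitaryGroup (Fin n) ℂ) : Matrix (Fin n) (Fin n) ℂ) i j) 0 0 := by
        refine (hasDerivAt_const (0 : ℝ)
          (((V e : Matrix.specialUnitaryGroup (Fin n) ℂ) : Matrix (Fin n) (Fin n) ℂ) i j)).congr_of_eventuallyEq ?_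
        exact Eventually.of_forall fun s => by simp only [h s]
      exact h1.unique h2
    ext i j
    rw [key i j, Matrix.zero_apply]

omit [NeZero L] in
/-- Universal fixed points stay fixed under any number of steps. -/
theorem iterate_wilsonFlowRK3_eq_self {V : GaugeConfig d L (Matrix.specialUnitaryGroup (Fin n) ℂ)}
    (h : ∀ e, wilsonFlowVF V e = 0) (ε : ℝ) (m : ℕ) : (wilsonFlowRK3 ε)^[m] V = V :=
  Function.iterate_fixed (wilsonFlowRK3_eq_self_of_wilsonFlowVF_eq_zero h ε) m

end FixedPoints

/-! ## §2 Cooling-stable `SU(2)` configurations are fixed by the engine's flow step -/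

section Cooling

/-- **A configuration that no `SU(2)` cooling update moves is fixed by the RK3 flow step, at every step size**
(every link aligned with its staple sum ⇒ `wilsonFlowVF = 0` by `SU2CoolingFixedPoints`, then
`wilsonFlowRK3_eq_self_of_wilsonFlowVF_eq_zero`). -/
theorem wilsonFlowRK3_eq_self_of_su2Cool_eq_self {U : GaugeConfig d L (Matrix.specialUnitaryGroup (Fin 2) ℂ)}
    (h : ∀ (x : Site d L) (μ : Fin d), su2Cool U x μ = U) (ε : ℝ) : wilsonFlowRK3 ε U = U :=
  wilsonFlowRK3_eq_self_of_wilsonFlowVF_eq_zero (fun e => wilsonFlowVF_eq_zero_of_su2Cool_eq_self (h e.1 e.2)) ε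

/-- … hence by the whole measurement flow (any number of steps): on such a configuration the flowed and the
unflowed observables coincide. -/
theorem iterate_wilsonFlowRK3_eq_self_of_su2Cool_eq_self {U : GaugeConfig d L (Matrix.specialUnitaryGroup (Fin 2) ℂ)}
    (h : ∀ (x : Site d L) (μ : Fin d), su2Cool U x μ = U) (ε : ℝ) (m : ℕ) : (wilsonFlowRK3 ε)^[m] U = U :=
  Function.iterate_fixed (wilsonFlowRK3_eq_self_of_su2Cool_eq_self h ε) m

/-- The relational version: a configuration that is an exact cooling step of itself at every link (stable under
EVERY exact cooling implementation, any visiting order) is fixed by the RK3 flow step (`L ≥ 2`). -/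
theorem wilsonFlowRK3_eq_self_of_isCoolingStep_self [NeZero L] (hL : 2 ≤ L)
    {U : GaugeConfig d L (Matrix.specialUnitaryGroup (Fin 2) ℂ)}
    (h : ∀ (x : Site d L) (μ : Fin d), IsCoolingStep (fundamentalRep (Fin 2)) (x, μ) U U) (ε : ℝ) :
    wilsonFlowRK3 ε U = U := by
  refine wilsonFlowRK3_eq_self_of_su2Cool_eq_self (fun x μ => ?_) ε
  by_cases h0 : stapleSum (fundamentalRep (Fin 2)) U x μ = 0
  · exact su2Cool_of_eq_zero h0
  · exact ((h x μ).eq_su2Cool hL h0).symm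

end Cooling

end Summit.Ventures.LatticeQCDFlow.Scoring

end
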